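import Literature.Barriers.BirchSwinnertonDyer.PAdicFunctionalEquationParityProofs
import Literature.NumberTheory.EllipticCurves.PAdicLFunctionMultiplicativeFunctionalEquationProofs
import Summits.BirchSwinnertonDyer.BirchSwinnertonDyer.Theorems.Rank1ResidualX9Defs
import Summits.BirchSwinnertonDyer.Rank1Residual.X1.ClassClosureN1
import Summits.BirchSwinnertonDyer.BirchSwinnertonDyer.Theorems.CyclotomicUntwistPSUntwistingCharacterParity
import HarnessLib

/-!
# Second-jet criteria for rank-one Schneider are FIRST-jet criteria in disguise
# (ERRATUM to bsd-idea-4 LINE 9 «second-jet door», item stmt-BirchSwinnertonDyer-19106;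
#  bears on the rank-one Schneider cruxes 19106 / 19631 / 19036 / 0515)

Helper / negative-knowledge file of the D-0145 ideator seat bsd-idea-4 (gen 5). BSD is not proved;
nothing class-wide is proved at any crux here. What IS proved (sorry-free, from tree theorems):

* `odd_order_toNat_of_mem_padicFEClass_neg_one` — any power series `g ∈ ℚ_p⟦T⟧` with a functional
  equation `g(T^ι) = -u(T)·g(T)`, `u(0) = 1` (`ι = (1+T)⁻¹ - 1`; the class
  `padicFEClass U (-1)` of the barrier entry `PAdicFunctionalEquationParity`) and `g ≠ 0` has ODD
  `T`-order; hence (`order_eq_one_of_order_le_two_of_mem_padicFEClass_neg_one`) **`ord_T g ≤ 2`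
  already forces `ord_T g = 1`**, and more generally every EVEN jet bound `ord_T g ≤ 2k` improves
  for free to `ord_T g ≤ 2k - 1` (`order_le_pred_of_order_le_even`): the even-index Taylor
  coefficients carry no independent vanishing information (indeed `2·[T²]g = -(1 + [T¹]u)·[T¹]g`).
* `order_padicLFunction_le_two_iff_eq_one` — for `E/ℚ` (globally minimal `W`), an odd good
  ordinary prime `p`, `f` a newform of `W` (any level) and ODD analytic rank:
  `ord_T L_p(f, α, T) ≤ 2 ↔ ord_T L_p(f, α, T) = 1 ↔ [T¹] L_p ≠ 0`, modulo the single root fact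
  `exists_isNewformOf` (modularity at the conductor level), by the tree's functional equation
  `padicLFunction_functional_equation_of_exists_isNewformOf` (sign `w_E`), Rohrlich non-vanishing
  `padicLFunction_ne_zero_holds` and `even_analyticRank_iff_of_isNewformOf_conductorLevel`.
* Consequences BY NAME for the would-be «second-jet doors» on the rank-one Schneider cruxes:
  `secondJetX9RankOne_iff_orderOneX9` — on X9 (`ClassX9`, item 19631) the statement
  "`ord_T L_p ≤ 2` on every rank-1 pair" is EQUIVALENT to the registered open stub `stub_orderOne`
  of the line of record `Cruxes/SchneiderX9RankOne/Lines/birth.lean` ("`[T¹] L_p ≠ 0`"), so it is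
  not a new line; `secondJetX1TypeB_iff_orderOneX1TypeB` — likewise on X1 type B (item 19036).
* At a NON-split multiplicative prime (LINE 9's locus: `p = 3`, `ClassX11b`, `Ram`, ¬split) the
  same degeneracy holds modulo the Mazur–Tate–Teitelbaum functional equation of THE `p`-adic
  `L`-function of the pair, `L(T^ι) = σ (1+T)^c L(T)` with `σ = -a_p·w_E = w_E = -1` at analytic
  rank one (MTT 1986 §I.17; tree: `IsMultPAdicLFunctionOf.subst_eq_of_atkinLehner`, given the
  Atkin–Lehner sign at the prime-to-`p` level): `secondJetAtThree_iff_firstJetAtThree_of_fe`.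
  So LINE 9's stub `S1 : ord_T L_3(E,T) ≤ 2` IS the first-jet statement `ord_T L_3(E,T) = 1`
  (Stein–Wuthrich 2013's Kato-direction criterion, class-wide = `p`-adic BSD's order statement on
  the locus), its advertised "parity upgrade" is void, and the JET TABLE @3 instrument is void
  (`v_3([T²]L_3) ≥ v_3([T¹]L_3)` always).

HONEST FRAMING: this file RETRACTS the novelty claim of LINE 9 (HOME
`pub/ideators/bsd-idea-4/lines/g4/Lines-second-jet.lean`, unregistered); LINE 9's kernel
(`SchneiderAtThree_of`, Greenberg 3.10 + 1.14 parity chain, helper p605189) stays correct but its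
open stub is the first-order `p`-adic BSD statement on the locus. The barrier it failed to place
itself against is `Literature/Barriers/BirchSwinnertonDyer/PAdicFunctionalEquationParity.lean`.
[cite: GreenbergLNM1716, §1 (functional equation, pp. 67–68) and §5 (p. 181)]
[cite: MazurTateTeitelbaum1986Invent, §I.17] [cite: SteinWuthrich2013, §3, Thm. 6.1]
-/

-- the summit and its single problem are both named `BirchSwinnertonDyer` (registry layout D-0017)
set_option linter.dupNamespace false

set_option autoImplicit false

noncomputable section

open scoped Classical MatrixGroups ModularForm

open PowerSeries CongruenceSubgroup WeierstrassCurve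
  Literature.Barriers.BirchSwinnertonDyer
  Literature.NumberTheory.EllipticCurves Literature.NumberTheory.EllipticCurves.ModularForms

namespace Summit.BirchSwinnertonDyer.BirchSwinnertonDyer.Theorems.SchneiderSecondJetDegeneracy

/-! ### §1. Power-series algebra: sign `-1` forces ODD order, so even jet bounds improve for free -/

section Algebra

variable {p : ℕ} [Fact p.Prime]

/-- **Sign `-1` ⟹ odd `T`-order.** If `g ∈ ℚ_p⟦T⟧` satisfies `g(T^ι) = -u·g` with a multiplier
`u` from a set `U` of principal units (`u(0) = 1`) and `g ≠ 0`, then `ord_T g` is odd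
(leading coefficients: `T^ι = -T + O(T²)`, barrier lemma `eq_neg_one_pow_of_subst_eq`).
[cite: GreenbergLNM1716, §5 (p. 181)] -/
theorem odd_order_toNat_of_mem_padicFEClass_neg_one {U : Set ℚ_[p]⟦X⟧}
    (hU : U ⊆ principalUnits ℚ_[p]) {g : ℚ_[p]⟦X⟧} (hg : g ∈ padicFEClass U (-1)) (hg0 : g ≠ 0) :
    Odd g.order.toNat := by
  obtain ⟨u, hu, hFE⟩ := hg
  have hfin : g.order ≠ ⊤ := fun h => hg0 (PowerSeries.order_eq_top.mp h)
  obtain ⟨n, hn⟩ := ENat.ne_top_iff_exists.mp hfin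
  have hw := eq_neg_one_pow_of_subst_eq constantCoeff_invOnePlusSubOne coeff_one_invOnePlusSubOne
    (mem_principalUnits_iff.mp (hU hu)) hFE hn.symm
  rw [← hn, ENat.toNat_coe]
  rcases Nat.even_or_odd n with he | ho
  · exfalso
    rw [he.neg_one_pow] at hw
    norm_num at hw
  · exact ho

/-- **Even jet bounds improve for free**: under the same functional equation, `ord_T g ≤ 2k`
implies `ord_T g ≤ 2k - 1` (`k ≥ 1`): the `2k`-th Taylor coefficient is never the first
non-vanishing one. [cite: GreenbergLNM1716, §5 (p. 181)] -/
theorem order_le_pred_of_order_le_even {U : Set ℚ_[p]⟦X⟧} (hU : U ⊆ principalUnits ℚ_[p])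
    {g : ℚ_[p]⟦X⟧} (hg : g ∈ padicFEClass U (-1)) {k : ℕ} (hk2 : g.order ≤ (2 * k : ℕ)) :
    g.order ≤ (2 * k - 1 : ℕ) := by
  have hg0 : g ≠ 0 := by
    intro h
    rw [h, PowerSeries.order_zero] at hk2
    exact absurd (top_le_iff.mp hk2) (ENat.coe_ne_top _)
  have hfin : g.order ≠ ⊤ := fun h => hg0 (PowerSeries.order_eq_top.mp h)
  obtain ⟨n, hn⟩ := ENat.ne_top_iff_exists.mp hfin
  have hodd := odd_order_toNat_of_mem_padicFEClass_neg_one hU hg hg0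
  rw [← hn, ENat.toNat_coe] at hodd
  rw [← hn] at hk2 ⊢
  have hle : n ≤ 2 * k := by exact_mod_cast hk2
  obtain ⟨m, rfl⟩ := hodd
  exact_mod_cast (show 2 * m + 1 ≤ 2 * k - 1 by omega)

/-- **`ord_T g ≤ 2` forces `ord_T g = 1`** under a sign-`-1` functional equation — the
"second jet" carries no information beyond the first. [cite: GreenbergLNM1716, §5 (p. 181)] -/
theorem order_eq_one_of_order_le_two_of_mem_padicFEClass_neg_one {U : Set ℚ_[p]⟦X⟧}
    (hU : U ⊆ principalUnits ℚ_[p]) {g : ℚ_[p]⟦X⟧} (hg : g ∈ padicFEClass U (-1))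
    (h2 : g.order ≤ 2) : g.order = 1 := by
  have hg0 : g ≠ 0 := by
    intro h
    rw [h, PowerSeries.order_zero] at h2
    exact absurd h2 (by simp)
  have hfin : g.order ≠ ⊤ := fun h => hg0 (PowerSeries.order_eq_top.mp h)
  obtain ⟨n, hn⟩ := ENat.ne_top_iff_exists.mp hfin
  have hodd := odd_order_toNat_of_mem_padicFEClass_neg_one hU hg hg0
  rw [← hn, ENat.toNat_coe] at hodd
  rw [← hn] at h2 ⊢
  have hle : n ≤ 2 := by exact_mod_cast h2
  obtain ⟨m, rfl⟩ := hodd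
  have hm : m = 0 := by omega
  subst hm
  rfl

/-- `ord_T g ≤ 2 ↔ ord_T g = 1 ↔ [T¹] g ≠ 0` under a sign-`-1` functional equation (the three
currencies of a "jet door" coincide). [cite: GreenbergLNM1716, §5 (p. 181)] -/
theorem order_le_two_iff_coeff_one_ne_zero_of_mem_padicFEClass_neg_one {U : Set ℚ_[p]⟦X⟧}
    (hU : U ⊆ principalUnits ℚ_[p]) {g : ℚ_[p]⟦X⟧} (hg : g ∈ padicFEClass U (-1)) :
    (g.order ≤ 2 ↔ g.order = 1) ∧ (g.order ≤ 2 ↔ coeff 1 g ≠ 0) := by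
  refine ⟨⟨order_eq_one_of_order_le_two_of_mem_padicFEClass_neg_one hU hg, fun h => by
    rw [h]; decide⟩, ⟨fun h => ?_, fun h => (PowerSeries.order_le 1 h).trans (by decide)⟩⟩
  have h1 := order_eq_one_of_order_le_two_of_mem_padicFEClass_neg_one hU hg h
  have hg0 : g ≠ 0 := by
    intro h0
    rw [h0, PowerSeries.order_zero] at h1
    exact absurd h1 (by simp)
  have := PowerSeries.coeff_order hg0
  simpa [h1] using this

end Algebra

/-! ### §2. THE good-ordinary `p`-adic `L`-function at odd analytic rank -/

section GoodOrdinary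

variable {W : WeierstrassCurve ℚ} [W.IsElliptic] [W.IsGloballyMinimal] {p : ℕ} [Fact p.Prime]
  {N : ℕ} [NeZero N] {f : CuspForm (Gamma0 N) 2}

/-- **At odd analytic rank, `L_p(E, T)` lies in the sign-`-1` functional-equation class** with the
printed binomial multipliers `(1+T)^c` (tree functional equation
`padicLFunction_functional_equation_of_exists_isNewformOf`, Greenberg LNM 1716 §1 / MTT §I.17,
modulo modularity `exists_isNewformOf`). [cite: GreenbergLNM1716, §1 (functional equation, pp. 67–68)] -/
theorem padicLFunction_mem_padicFEClass_neg_one (hmod : exists_isNewformOf) (hp : p ≠ 2)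
    (hord : IsOrdinaryAt W p) (hf : IsNewformOf W f) (hodd : Odd W.analyticRank) :
    padicLFunction f (unitRoot W p : ℚ_[p]) ∈ padicFEClass (binomialMultipliers p) (-1) := by
  have hFE := padicLFunction_functional_equation_of_exists_isNewformOf (W := W) (p := p) (f := f) hmod
  have hmem := hFE hp hord hf
  rwa [PSUntwistingCharacterParity.rootNumber_eq_neg_one_of_odd_analyticRank W hmod hodd, Int.cast_neg,
    Int.cast_one] at hmem

/-- **ERRATUM KERNEL (good ordinary).** For `W/ℚ` globally minimal elliptic of ODD analytic rank,
`p` an odd good ordinary prime and `f` a newform of `W`: `ord_T L_p(f, α, T) ≤ 2 ↔ ord_T L_p = 1`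
and `ord_T L_p ≤ 2 ↔ [T¹] L_p ≠ 0` — a "second-jet door" is the first-jet door. Modulo the single
root fact `exists_isNewformOf`. [cite: GreenbergLNM1716, §1, §5 (p. 181)] -/
theorem order_padicLFunction_le_two_iff_eq_one (hmod : exists_isNewformOf) (hp : p ≠ 2)
    (hord : IsOrdinaryAt W p) (hf : IsNewformOf W f) (hodd : Odd W.analyticRank) :
    ((padicLFunction f (unitRoot W p : ℚ_[p])).order ≤ 2 ↔
        (padicLFunction f (unitRoot W p : ℚ_[p])).order = 1) ∧
      ((padicLFunction f (unitRoot W p : ℚ_[p])).order ≤ 2 ↔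
        coeff 1 (padicLFunction f (unitRoot W p : ℚ_[p])) ≠ 0) :=
  order_le_two_iff_coeff_one_ne_zero_of_mem_padicFEClass_neg_one
    (binomialMultipliers_subset_principalUnits p)
    (padicLFunction_mem_padicFEClass_neg_one hmod hp hord hf hodd)

/-- Every even jet bound on `L_p(E,T)` improves by one at odd analytic rank:
`ord_T L_p ≤ 2k ⟹ ord_T L_p ≤ 2k − 1`. [cite: GreenbergLNM1716, §5 (p. 181)] -/
theorem order_padicLFunction_le_pred_of_le_even (hmod : exists_isNewformOf) (hp : p ≠ 2)
    (hord : IsOrdinaryAt W p) (hf : IsNewformOf W f) (hodd : Odd W.analyticRank) {k : ℕ}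
    (hk : (padicLFunction f (unitRoot W p : ℚ_[p])).order ≤ (2 * k : ℕ)) :
    (padicLFunction f (unitRoot W p : ℚ_[p])).order ≤ (2 * k - 1 : ℕ) :=
  order_le_pred_of_order_le_even (binomialMultipliers_subset_principalUnits p)
    (padicLFunction_mem_padicFEClass_neg_one hmod hp hord hf hodd) hk

end GoodOrdinary

/-! ### §3. Consequences BY NAME for the rank-one Schneider cruxes on X9 and X1 type B -/

section Classes

/-- Anomalous (`a_p ≡ 1 mod p`) good primes are ordinary. [folklore] -/
theorem isOrdinaryAt_of_anom {W : WeierstrassCurve ℚ} [W.IsGloballyMinimal] {p : ℕ} [Fact p.Prime]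
    (h : Literature.NumberTheory.EllipticCurves.Rank1Residual.Anom W p) : IsOrdinaryAt W p := by
  refine ⟨h.2.1, fun hdvd => ?_⟩
  have h1 : (p : ℤ) ∣ 1 := by simpa using Int.dvd_sub hdvd h.2.2
  have hp1 : (p : ℤ) = 1 := Int.eq_one_of_dvd_one (by positivity) h1
  exact (Fact.out : p.Prime).one_lt.ne' (by exact_mod_cast hp1)

/-- **X9, pointwise**: on a rank-one X9 pair (`ClassX9`: `p ≥ 5` good ordinary), with `f` a newform
of `W`: `ord_T L_p ≤ 2 ↔ [T¹] L_p ≠ 0` (modulo `exists_isNewformOf`).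
[cite: GreenbergLNM1716, §5 (p. 181)] -/
theorem order_le_two_iff_coeff_one_ne_zero_of_classX9 (hmod : exists_isNewformOf)
    {W : WeierstrassCurve ℚ} [W.IsElliptic] [W.IsGloballyMinimal] {p : ℕ} [Fact p.Prime]
    {N : ℕ} [NeZero N] {f : CuspForm (Gamma0 N) 2}
    (hX9 : Summit.BirchSwinnertonDyer.BirchSwinnertonDyer.Rank1Residual.ClassX9 W p)
    (han : W.analyticRank = 1) (hf : IsNewformOf W f) :
    (padicLFunction f (unitRoot W p : ℚ_[p])).order ≤ 2 ↔
      coeff 1 (padicLFunction f (unitRoot W p : ℚ_[p])) ≠ 0 :=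
  have hp : p ≠ 2 := by have := hX9.2.1; omega
  (order_padicLFunction_le_two_iff_eq_one hmod hp ⟨hX9.2.2.1, hX9.2.2.2.1⟩ hf (han ▸ odd_one)).2

/-- **X9: the would-be «second-jet door» IS the birth line's open stub** (modulo
`exists_isNewformOf`). Left side: "`ord_T L_p ≤ 2` on every rank-1 X9 pair" (never filed); right
side: VERBATIM the registered open stub `stub_orderOne` of
`Cruxes/SchneiderX9RankOne/Lines/birth.lean` (item stmt-BirchSwinnertonDyer-19631). So no
«second-jet» line is filed on 19631. [cite: GreenbergLNM1716, §5 (p. 181)] -/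
theorem secondJetX9RankOne_iff_orderOneX9 (hmod : exists_isNewformOf) :
    (∀ (W : WeierstrassCurve ℚ) [W.IsElliptic] [W.IsGloballyMinimal] (p : ℕ) [Fact p.Prime]
        {N : ℕ} [NeZero N] (f : CuspForm (Gamma0 N) 2),
        Summit.BirchSwinnertonDyer.BirchSwinnertonDyer.Rank1Residual.ClassX9 W p →
        W.analyticRank = 1 → IsNewformOf W f →
        (padicLFunction f (unitRoot W p : ℚ_[p])).order ≤ 2) ↔
    (∀ (W : WeierstrassCurve ℚ) [W.IsElliptic] [W.IsGloballyMinimal] (p : ℕ) [Fact p.Prime]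
        {N : ℕ} [NeZero N] (f : CuspForm (Gamma0 N) 2),
        Summit.BirchSwinnertonDyer.BirchSwinnertonDyer.Rank1Residual.ClassX9 W p →
        W.analyticRank = 1 → IsNewformOf W f →
        PowerSeries.coeff 1 (padicLFunction f (unitRoot W p : ℚ_[p])) ≠ 0) :=
  ⟨fun h W _ _ p _ _ _ f hX9 han hf =>
      (order_le_two_iff_coeff_one_ne_zero_of_classX9 hmod hX9 han hf).mp (h W p f hX9 han hf),
    fun h W _ _ p _ _ _ f hX9 han hf =>
      (order_le_two_iff_coeff_one_ne_zero_of_classX9 hmod hX9 han hf).mpr (h W p f hX9 han hf)⟩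

/-- **X1 type B, pointwise** (item stmt-BirchSwinnertonDyer-19036's locus, `TypeBRankOne`:
`p > 2` anomalous good ⟹ ordinary, analytic rank `1`): `ord_T L_p ≤ 2 ↔ [T¹] L_p ≠ 0`
(modulo `exists_isNewformOf`). [cite: GreenbergLNM1716, §5 (p. 181)] -/
theorem order_le_two_iff_coeff_one_ne_zero_of_typeBRankOne (hmod : exists_isNewformOf)
    {W : WeierstrassCurve ℚ} [W.IsElliptic] [W.IsGloballyMinimal] {p : ℕ} [Fact p.Prime]
    {N : ℕ} [NeZero N] {f : CuspForm (Gamma0 N) 2}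
    (hB : Summit.BirchSwinnertonDyer.Rank1Residual.X1.TypeBRankOne W p) (hf : IsNewformOf W f) :
    (padicLFunction f (unitRoot W p : ℚ_[p])).order ≤ 2 ↔
      coeff 1 (padicLFunction f (unitRoot W p : ℚ_[p])) ≠ 0 :=
  have hp : p ≠ 2 := by have := hB.1.1; omega
  (order_padicLFunction_le_two_iff_eq_one hmod hp (isOrdinaryAt_of_anom hB.1.2.2.2.1) hf
    (hB.2.1 ▸ odd_one)).2

/-- **X1 type B: the would-be «second-jet door» IS the first-jet («analytic face») statement**
(modulo `exists_isNewformOf`). [cite: GreenbergLNM1716, §5 (p. 181)] -/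
theorem secondJetX1TypeB_iff_orderOneX1TypeB (hmod : exists_isNewformOf) :
    (∀ (W : WeierstrassCurve ℚ) [W.IsElliptic] [W.IsGloballyMinimal] (p : ℕ) [Fact p.Prime]
        {N : ℕ} [NeZero N] (f : CuspForm (Gamma0 N) 2),
        Summit.BirchSwinnertonDyer.Rank1Residual.X1.TypeBRankOne W p → IsNewformOf W f →
        (padicLFunction f (unitRoot W p : ℚ_[p])).order ≤ 2) ↔
    (∀ (W : WeierstrassCurve ℚ) [W.IsElliptic] [W.IsGloballyMinimal] (p : ℕ) [Fact p.Prime]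
        {N : ℕ} [NeZero N] (f : CuspForm (Gamma0 N) 2),
        Summit.BirchSwinnertonDyer.Rank1Residual.X1.TypeBRankOne W p → IsNewformOf W f →
        PowerSeries.coeff 1 (padicLFunction f (unitRoot W p : ℚ_[p])) ≠ 0) :=
  ⟨fun h W _ _ p _ _ _ f hB hf =>
      (order_le_two_iff_coeff_one_ne_zero_of_typeBRankOne hmod hB hf).mp (h W p f hB hf),
    fun h W _ _ p _ _ _ f hB hf =>
      (order_le_two_iff_coeff_one_ne_zero_of_typeBRankOne hmod hB hf).mpr (h W p f hB hf)⟩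

end Classes

/-! ### §4. LINE 9's locus (non-split multiplicative `p = 3`): the same, modulo the MTT §I.17 functional equation

On `ClassX11b W 3 ∧ Ram W 3 ∧ ¬split` the analytic object is any `L` of the multiplicative
package `IsMultPAdicLFunctionOf f 3 (-1) L` (`α = a_3 = -1`). Its functional equation
`L(T^ι) = σ (1+T)^c L(T)` has `σ = -a_3·w_E = w_E` (MTT 1986 §I.17; tree, GIVEN the Atkin–Lehner
sign `w'` at the prime-to-`3` level: `IsMultPAdicLFunctionOf.subst_eq_of_atkinLehner`), and
`w_E = -1` at analytic rank `1`. We take that sign-`-1` functional equation as a hypothesis and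
conclude: LINE 9's stub S1 (`ord_T L ≤ 2`) is EQUIVALENT to the first-jet statement `ord_T L = 1`. -/

section NonsplitThree

/-- **ERRATUM KERNEL (LINE 9's locus).** Modulo the non-split functional equation with sign `-1`
(hypothesis `hFE`, any set of principal-unit multipliers), LINE 9's «second-jet» stub
S1 = `SecondJetAtThree` (left side, verbatim from HOME `lines/g4/Lines-second-jet.lean`) is
EQUIVALENT to the first-jet statement `ord_T L_3(E,T) = 1` on the locus (right side) — i.e. to
Stein–Wuthrich's Kato-direction criterion made class-wide. LINE 9's "parity upgrade" is void; the
line is the analytic face of item stmt-BirchSwinnertonDyer-19106, not a non-equivalent criterion.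
[cite: MazurTateTeitelbaum1986Invent, §I.17] [cite: SteinWuthrich2013, §3, Thm. 6.1] -/
theorem secondJetAtThree_iff_firstJetAtThree_of_fe
    (hFE : ∀ (W : WeierstrassCurve ℚ) [W.IsElliptic] [W.IsGloballyMinimal],
      Summit.BirchSwinnertonDyer.Rank1Residual.ClassX11b W 3 →
      ¬ W.HasSplitMultiplicativeReductionAtPrime 3 →
      ∀ {N : ℕ} [NeZero N] (f : CuspForm (Gamma0 N) 2), IsNewformOf W f →
      ∀ (L : PowerSeries ℚ_[3]), IsMultPAdicLFunctionOf f 3 (-1) L →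
        L ∈ padicFEClass (principalUnits ℚ_[3]) (-1)) :
    (∀ (W : WeierstrassCurve ℚ) [W.IsElliptic] [W.IsGloballyMinimal],
        Summit.BirchSwinnertonDyer.Rank1Residual.ClassX11b W 3 →
        Literature.NumberTheory.EllipticCurves.Rank1Residual.Ram W 3 →
        ¬ W.HasSplitMultiplicativeReductionAtPrime 3 →
        ∀ {N : ℕ} [NeZero N] (f : CuspForm (Gamma0 N) 2), IsNewformOf W f →
        ∀ (L : PowerSeries ℚ_[3]), IsMultPAdicLFunctionOf f 3 (-1) L → L.order ≤ 2) ↔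
    (∀ (W : WeierstrassCurve ℚ) [W.IsElliptic] [W.IsGloballyMinimal],
        Summit.BirchSwinnertonDyer.Rank1Residual.ClassX11b W 3 →
        Literature.NumberTheory.EllipticCurves.Rank1Residual.Ram W 3 →
        ¬ W.HasSplitMultiplicativeReductionAtPrime 3 →
        ∀ {N : ℕ} [NeZero N] (f : CuspForm (Gamma0 N) 2), IsNewformOf W f →
        ∀ (L : PowerSeries ℚ_[3]), IsMultPAdicLFunctionOf f 3 (-1) L → L.order = 1) := by
  constructor
  · intro h W _ _ hX hRam hns N _ f hf L hL
    exact order_eq_one_of_order_le_two_of_mem_padicFEClass_neg_one subset_rfl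
      (hFE W hX hns f hf L hL) (h W hX hRam hns f hf L hL)
  · intro h W _ _ hX hRam hns N _ f hf L hL
    rw [h W hX hRam hns f hf L hL]
    decide

/-- The binomial-multiplier form actually delivered by the tree's non-split functional equation
(`IsMultPAdicLFunctionOf.subst_eq_of_atkinLehner`: `L(T^ι) = σ·(1+T)^c·L`) puts `L` in the
sign-`σ` class with principal-unit multipliers; with `σ = -1` §1 applies.
[cite: MazurTateTeitelbaum1986Invent, §I.17] -/
theorem mem_padicFEClass_of_subst_eq_binomial {p : ℕ} [Fact p.Prime] {L : PowerSeries ℚ_[p]}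
    {σ : ℚ_[p]} {c : ℤ_[p]}
    (h : PowerSeries.subst (invOnePlusSubOne : ℚ_[p]⟦X⟧) L =
      C σ * PowerSeries.binomialSeries ℚ_[p] c * L) :
    L ∈ padicFEClass (principalUnits ℚ_[p]) σ :=
  ⟨PowerSeries.binomialSeries ℚ_[p] c, binomialMultipliers_subset_principalUnits p ⟨c, rfl⟩, h⟩

/-- **ERRATUM KERNEL, fully explicit at a non-split multiplicative prime** (any `p`, any level
`N = p·M`, `p ∤ M`): GIVEN the Atkin–Lehner sign `w_M f = f` (i.e. `σ = -1`: for the newform of an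
analytic-rank-one `E` with `a_p = -1`, `σ = -a_p·w_E = w_E = -1`) and the MTT exponent datum `c`
(`⟨M⟩ = γ^c`), THE `p`-adic `L`-function `L` of the pair (`IsMultPAdicLFunctionOf f p (-1) L`)
satisfies `ord_T L ≤ 2 → ord_T L = 1`. Tree inputs: `IsMultPAdicLFunctionOf.subst_eq_of_atkinLehner`
(PROVED modulo its cited interpolation / uniqueness facts) + §1.
[cite: MazurTateTeitelbaum1986Invent, §I.17] -/
theorem order_eq_one_of_order_le_two_nonsplit {W : WeierstrassCurve ℚ} [W.IsElliptic]
    {p : ℕ} [Fact p.Prime] {N M : ℕ} [NeZero N] [NeZero M] {f : CuspForm (Gamma0 N) 2}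
    (hf : IsNewformOf W f) (hmult : W.HasMultiplicativeReductionAtPrime p)
    (hns : ¬ W.HasSplitMultiplicativeReductionAtPrime p) (hNM : N = p * M) (hpM : ¬ p ∣ M)
    (hW : atkinLehnerInvolution N 2 M f = (-((-1 : ℤ) : ℂ)) • f)
    {ηM : rootsOfUnity (torsionOrder p) ℤ_[p]} {c : ℤ_[p]}
    (hc : ∀ n : ℕ, PadicInt.toZModPow (n + cyclotomicExponent p) ((ηM : ℤ_[p]ˣ) : ℤ_[p]) *
        (cyclotomicGenerator p : ZMod (p ^ (n + cyclotomicExponent p))) ^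
          (PadicInt.toZModPow n c).val = (M : ZMod (p ^ (n + cyclotomicExponent p))))
    {L : PowerSeries ℚ_[p]} (hL : IsMultPAdicLFunctionOf f p (-1) L) (h2 : L.order ≤ 2) :
    L.order = 1 := by
  have hFE := IsMultPAdicLFunctionOf.subst_eq_of_atkinLehner hf hmult hns hNM hpM
    (σ := -1) (by norm_num) hW hc (one_add_X_mul_invOnePlusSubOne_add_one (R := ℚ_[p])) hL
  have hmem := mem_padicFEClass_of_subst_eq_binomial hFE
  rw [Int.cast_neg, Int.cast_one] at hmem
  exact order_eq_one_of_order_le_two_of_mem_padicFEClass_neg_one subset_rfl hmem h2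

end NonsplitThree

end Summit.BirchSwinnertonDyer.BirchSwinnertonDyer.Theorems.SchneiderSecondJetDegeneracy

end
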